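import Summits.QuantumFields.YangMills.Theses.SmallCircleAnchor

/-!
# Gauge covariance of plaquettes and Polyakov lines; gauge invariance of the pinned weight

Helpers for crux stmt-QuantumFields-11141 (`AnchorGap`, route `SmallCircleAnchor`), used by the
Elitzur reduction `SmallCircleAnchorAnchorGapElitzurReduction`:

* `plaquette_gauge` — plaquette holonomies are conjugated by `h x` under a gauge transformation
  (abstract shift map with commuting shifts);
* `prod_ofFn_telescope` — telescoping of ordered products (the Polyakov line is conjugated by
  `h (0, x)`), `trace_rep_conj`;
* lattice geometry of `ℤ_T × (ℤ/L)³`: `endpoints_mem_cube` (links based in a `w`-cube have both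
  endpoints in the `(w+1)`-cube), `not_mem_cube_of_translate` (for `w + 1 < n`, `2n < L` the
  `(w+1)`-cube and its translate by `n e₀` are disjoint);
* `soft_weight_gauge_invariant` — the `E(β)V`-pinned finite-temperature Wilson weight of the crux
  (inline vocabulary, verbatim) is gauge invariant for every class function `V` (registered
  sub-goal).
-/

set_option autoImplicit false

noncomputable section

namespace Summit.QuantumFields.YangMills.Theorems.AnchorGap

open MeasureTheory
open Literature.MathematicalPhysics.QuantumFieldTheory

namespace GaugeAvg

/-! ### Covariance of plaquettes and Polyakov lines; telescoping products -/

section Covariance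

variable {St D : Type*} {G : Type*} [Group G]
variable (sh : St → D → St)
variable (gauge : (St → G) → (St × D → G) → (St × D → G))
variable (hgauge : ∀ (h : St → G) (U : St × D → G) (p : St × D),
  gauge h U p = h p.1 * U p * (h (sh p.1 p.2))⁻¹)

include hgauge

/-- **Plaquette holonomies are gauge covariant**: if the shifts commute,
`U_P(h • U)(x; μ, κ) = h x · U_P(U)(x; μ, κ) · (h x)⁻¹`. [folklore] -/
theorem plaquette_gauge (hsh : ∀ x μ κ, sh (sh x μ) κ = sh (sh x κ) μ) (h : St → G)
    (U : St × D → G) (x : St) (μ κ : D) :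
    gauge h U (x, μ) * gauge h U (sh x μ, κ) * (gauge h U (sh x κ, μ))⁻¹ * (gauge h U (x, κ))⁻¹ =
      h x * (U (x, μ) * U (sh x μ, κ) * (U (sh x κ, μ))⁻¹ * (U (x, κ))⁻¹) * (h x)⁻¹ := by
  simp only [hgauge, hsh x κ μ, mul_inv_rev, inv_inv]
  group

end Covariance

section Telescope

variable {G : Type*} [Group G]

/-- **Telescoping of an ordered product**:
`∏_{t<T} (a t · u t · (a (t+1))⁻¹) = a 0 · (∏_{t<T} u t) · (a T)⁻¹` (ordered `List` products in a
possibly non-commutative group). [folklore] -/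
theorem prod_ofFn_telescope (T : ℕ) (a : ℕ → G) (u : Fin T → G) :
    (List.ofFn fun t : Fin T => a t * u t * (a (t + 1))⁻¹).prod =
      a 0 * (List.ofFn u).prod * (a T)⁻¹ := by
  induction T with
  | zero => simp
  | succ T ih =>
    rw [List.ofFn_succ', List.ofFn_succ' u, List.prod_concat, List.prod_concat]
    have := ih (fun i => u (Fin.castSucc i))
    simp only [Fin.val_castSucc] at this ⊢
    rw [this, Fin.val_last]
    group

/-- The trace of a representation is a class function: `tr ρ(a g a⁻¹) = tr ρ(g)`. [folklore] -/
theorem trace_rep_conj {N : ℕ} (ρ : G →* Matrix (Fin N) (Fin N) ℂ) (a g : G) :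
    (ρ (a * g * a⁻¹)).trace = (ρ g).trace := by
  rw [map_mul, map_mul, Matrix.trace_mul_cycle, ← map_mul, inv_mul_cancel, map_one, one_mul]

end Telescope

/-! ### Geometry of the finite-temperature lattice `ℤ_T × (ℤ/L)³` -/

section Geometry

variable {T L : ℕ}

/-- A spatial unit step raises each cube coordinate by at most one:
`((y + e_j) i - c i).val ≤ (y i - c i).val + 1`. [folklore] -/
theorem val_sub_add_single_le [NeZero L] (y c : Fin 3 → ZMod L) (j i : Fin 3) :
    ((y + Pi.single j 1 : Fin 3 → ZMod L) i - c i).val ≤ (y i - c i).val + 1 := by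
  have h1 : (Pi.single (M := fun _ : Fin 3 => ZMod L) j (1 : ZMod L) i).val ≤ 1 := by
    rw [Pi.single_apply]
    split_ifs
    · rw [ZMod.val_one_eq_one_mod]; exact Nat.mod_le 1 L
    · rw [ZMod.val_zero]; exact Nat.zero_le 1
  have h2 : (y + Pi.single j 1 : Fin 3 → ZMod L) i - c i =
      (y i - c i) + Pi.single (M := fun _ : Fin 3 => ZMod L) j (1 : ZMod L) i := by
    simp only [Pi.add_apply]; ring
  rw [h2]
  exact (ZMod.val_add_le _ _).trans (by omega)

/-- **Endpoints of cube links lie in the enlarged cube**: if the base `x` of a link satisfies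
`(x.2 i - c i).val ≤ w` for all `i`, then both `x` and its shift `sh x μ` satisfy the same with
`w + 1`. [folklore] -/
theorem endpoints_mem_cube [NeZero L] {w : ℕ} (c : Fin 3 → ZMod L)
    (x : ZMod T × (Fin 3 → ZMod L)) (μ : Option (Fin 3)) (hx : ∀ i : Fin 3, (x.2 i - c i).val ≤ w) :
    (∀ i : Fin 3, (x.2 i - c i).val ≤ w + 1) ∧
      ∀ i : Fin 3, ((Option.elim μ (x.1 + 1, x.2) fun j => (x.1, x.2 + Pi.single j 1) :
        ZMod T × (Fin 3 → ZMod L)).2 i - c i).val ≤ w + 1 := by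
  refine ⟨fun i => (hx i).trans (Nat.le_succ w), fun i => ?_⟩
  cases μ with
  | none => exact (hx i).trans (Nat.le_succ w)
  | some j =>
    show ((x.2 + Pi.single j 1 : Fin 3 → ZMod L) i - c i).val ≤ w + 1
    exact (val_sub_add_single_le x.2 c j i).trans (Nat.succ_le_succ (hx i))

/-- **Separation**: for `w + 1 < n` and `2 n < L`, no site of the enlarged cube is the translate
by `n e₀` of a site of the enlarged cube (in coordinate `0` the two windows `[0, w+1]` and
`[n, n+w+1]` of `ℤ/L` are disjoint, without wrap-around since `n + w + 1 < 2n < L`). [folklore] -/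
theorem not_mem_cube_of_translate {w n : ℕ} (hwn : w + 1 < n) (hnL : 2 * n < L)
    (c : Fin 3 → ZMod L) (x : ZMod T × (Fin 3 → ZMod L))
    (hx : ∀ i : Fin 3, (x.2 i - c i).val ≤ w + 1) :
    ¬ ∀ i : Fin 3, ((x.2 + Pi.single 0 (n : ZMod L) : Fin 3 → ZMod L) i - c i).val ≤ w + 1 := by
  intro h
  haveI : NeZero L := ⟨by omega⟩
  have h0 := h 0
  have hx0 := hx 0
  have hn : (n : ZMod L).val = n := by rw [ZMod.val_natCast, Nat.mod_eq_of_lt (by omega)]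
  have heq : (x.2 + Pi.single 0 (n : ZMod L) : Fin 3 → ZMod L) 0 - c 0 =
      (x.2 0 - c 0) + (n : ZMod L) := by
    simp only [Pi.add_apply, Pi.single_eq_same]; ring
  rw [heq] at h0
  have hval : ((x.2 0 - c 0) + (n : ZMod L)).val = (x.2 0 - c 0).val + n := by
    rw [ZMod.val_add, hn, Nat.mod_eq_of_lt (by omega)]
  omega

end Geometry

/-! ### The pinned finite-temperature weight is gauge invariant (crux vocabulary) -/

section Soft

/-- **The `E(β)V`-pinned finite-temperature Wilson weight is gauge invariant** (crux `AnchorGap`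
vocabulary, verbatim `let`-chain): for every lattice gauge transformation `h : St → G`,
`wgt (h • U) = wgt U`, where `(h • U)(x, μ) = h x · U(x, μ) · (h (x + e_μ))⁻¹`. The Wilson term
is a sum of traces of plaquette holonomies, which are conjugated by `h x` (`plaquette_gauge`,
the shifts commute); the Polyakov line at `x` is conjugated by `h (0, x)` (telescoping of the
ordered product around the time circle, `prod_ofFn_telescope`), and `V` is a class function.
[folklore] -/
theorem soft_weight_gauge_invariant :
    ∀ (G : Type) [Group G] [TopologicalSpace G] [IsTopologicalGroup G] [CompactSpace G], letI : MeasurableSpace G := borel G; haveI : BorelSpace G := ⟨rfl⟩; ∀ (r : LatticeRep G) (V : G → ℝ), (∀ a g : G, V (a * g * a⁻¹) = V g) → ∀ (E : ℝ → ℝ) (T : ℕ) [NeZero T] (β : ℝ) (L : ℕ) [NeZero L], let St := ZMod T × (Fin 3 → ZMod L); let Cfg := St × Option (Fin 3) → G; let sh : St → Option (Fin 3) → St := fun x μ => Option.elim μ (x.1 + 1, x.2) fun i => (x.1, x.2 + Pi.single i 1); let pl : Cfg → St → Option (Fin 3) → Option (Fin 3) → G := fun U x μ κ => U (x, μ) *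 U (sh x μ, κ) * (U (sh x κ, μ))⁻¹ * (U (x, κ))⁻¹; let act : Cfg → ℝ := fun U => β * ∑ x : St, ∑ i : Fin 3, (r.ρ (pl U x none (some i))).trace.re + β * ∑ x : St, ∑ q : {q : Fin 3 × Fin 3 // q.1 < q.2}, (r.ρ (pl U x (some q.1.1) (some q.1.2))).trace.re; let P : Cfg → (Fin 3 → ZMod L) → G := fun U x => (List.ofFn fun t : Fin T => U ((((t : ℕ) : ZMod T), x), none)).prod; let wgt : Cfg → ℝ := fun U => Real.exp (act U - E β * ∑ x : Fin 3 → ZMod L, V (P U x)); let gauge : (St → G) → Cfg → Cfg := fun h U p => h p.1 * U p * (h (sh p.1 p.2))⁻¹; ∀ (h : St → G) (U : Cfg), wgt (gauge h U) = wgt U := by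
  intro G _ _ _ _
  letI : MeasurableSpace G := borel G
  haveI : BorelSpace G := ⟨rfl⟩
  intro r V hVcl E T _ β L _ St Cfg sh pl act P wgt gauge h U
  have hgauge : ∀ (h : St → G) (U : Cfg) (p : St × Option (Fin 3)),
      gauge h U p = h p.1 * U p * (h (sh p.1 p.2))⁻¹ := fun _ _ _ => rfl
  have hsh : ∀ (x : St) (μ κ : Option (Fin 3)), sh (sh x μ) κ = sh (sh x κ) μ := by
    rintro ⟨s, y⟩ (_ | i) (_ | j)
    · rfl
    · rfl
    · rfl
    · show ((s, y + Pi.single i 1 + Pi.single j 1) : St) = (s, y + Pi.single j 1 + Pi.single i 1)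
      rw [add_right_comm]
  have hpl : ∀ (x : St) (μ κ : Option (Fin 3)), pl (gauge h U) x μ κ = h x * pl U x μ κ * (h x)⁻¹ :=
    fun x μ κ => plaquette_gauge sh gauge hgauge hsh h U x μ κ
  have htr : ∀ (x : St) (μ κ : Option (Fin 3)),
      (r.ρ (pl (gauge h U) x μ κ)).trace.re = (r.ρ (pl U x μ κ)).trace.re := by
    intro x μ κ; rw [hpl, trace_rep_conj]
  have hact : act (gauge h U) = act U := by
    simp only [act, htr]
  have hP : ∀ x : Fin 3 → ZMod L, P (gauge h U) x = h (0, x) * P U x * (h (0, x))⁻¹ := by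
    intro x
    set a : ℕ → G := fun t => h (((t : ℕ) : ZMod T), x) with ha
    have hfun : (fun t : Fin T => gauge h U ((((t : ℕ) : ZMod T), x), none)) =
        fun t : Fin T => a t * U ((((t : ℕ) : ZMod T), x), none) * (a ((t : ℕ) + 1))⁻¹ := by
      funext t
      simp only [ha, Nat.cast_succ]
      rfl
    have h0 : a 0 = h (0, x) := by simp [ha]
    have hT : a T = h (0, x) := by simp [ha]
    show (List.ofFn fun t : Fin T => gauge h U ((((t : ℕ) : ZMod T), x), none)).prod =
      h (0, x) * (List.ofFn fun t : Fin T => U ((((t : ℕ) : ZMod T), x), none)).prod * (h (0, x))⁻¹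
    rw [hfun, prod_ofFn_telescope T a, h0, hT]
  have hV : ∀ x : Fin 3 → ZMod L, V (P (gauge h U) x) = V (P U x) := by
    intro x; rw [hP, hVcl]
  show Real.exp (act (gauge h U) - E β * ∑ x : Fin 3 → ZMod L, V (P (gauge h U) x)) =
    Real.exp (act U - E β * ∑ x : Fin 3 → ZMod L, V (P U x))
  rw [hact]
  simp only [hV]

end Soft

end GaugeAvg

end Summit.QuantumFields.YangMills.Theorems.AnchorGap

end
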